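import Mathlib
import HarnessLib
import Summits.HubbardSuperconductivity.HubbardSuperconductivity.Theorems.KLProgrammeKLRegimeEnginePairLadderFlowStep

/-!
# Route `KLProgramme` — crux K3, ENGINE child gen 7-flow (stmt-HubbardSuperconductivity-20368 `KLRegimeEngineV17F`), stub `stub_engine_step_values`,
# conjuncts (E2″-F)/(E2′-F) at `1 ≤ n`: the plain increment of the within-slice flow WITH the linear leg term — `kltc_increment_of_flow_lin`

Cell gate-hubbard-kl, seat hubbard-kl-k3c1-p1 (g7), technique «composed-map remainder propagation».  Twin of `kltc_increment_of_flow` (p501875) for the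
organisation of record after E2-SIGMA-DRESSING: the split `Γ̇ = −Γ·diag ḃ·Γ − diag α̇·Γ − Γ·diag γ̇ + X` (dressed rungs `ḃ`, one-line leg insertion rates `α̇, γ̇`,
source `X`).  For the VALUE-INCREMENT clauses no resummation and no conjugation are needed: by the fundamental theorem of calculus
`‖Γ(1)(x,y) − Γ(0)(x,y)‖ ≤ ∫₀¹‖X_t(x,y)‖dt + m²·∫₀¹Σ_c‖ḃ_t(c)‖dt + m·∫₀¹(‖α̇_t(x)‖ + ‖γ̇_t(y)‖)dt` — source, rung-rate mass (ppGain-shaped through that mass), and the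
leg-dressing term at the EXTERNAL legs only (the (D) shape of (E2″-F)).  Real analysis; nothing about the model is asserted.  0 kit.
-/

noncomputable section

namespace Summit.HubbardSuperconductivity.HubbardSuperconductivity.Theorems.KLRegimeSplit

set_option linter.dupNamespace false -- summit = problem name (single-conjunct summit), D-0017

open Finset Matrix Set Literature.MathematicalPhysics.QuantumLattice Literature.Probability.LatticeModels
open Summit.HubbardSuperconductivity.HubbardSuperconductivity.Theorems.KLProgrammeCooperResummation

section Generic

variable {S F : Type*} [Fintype S] [DecidableEq S] [Fintype F] [DecidableEq F]

/-- **Increment of the within-slice flow with the linear leg term.**  `Γ, Γ̇, X : ℝ → Matrix`, continuous rung rate `ḃ` and leg rates `α̇, γ̇`, the split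
`X = Γ̇ + Γ·diag ḃ·Γ + diag α̇·Γ + Γ·diag γ̇`, a priori `|Γ| ≤ m` on `[0,1]`:
`‖Γ(1)(x,y) − Γ(0)(x,y)‖ ≤ ∫₀¹‖X_t(x,y)‖ + m²·∫₀¹Σ_c‖ḃ_t(c)‖ + m·∫₀¹(‖α̇_t(x)‖ + ‖γ̇_t(y)‖)`. -/
theorem kltc_increment_of_flow_lin (Γ Γ' X : ℝ → Matrix (S × F) (S × F) ℂ) (b' αd γd : ℝ → S × F → ℂ) {m : ℝ} (hm : 0 ≤ m)
    (hΓ : ∀ t ∈ Icc (0 : ℝ) 1, ∀ x y, HasDerivAt (fun s => Γ s x y) (Γ' t x y) t)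
    (hΓ'c : ∀ x y, ContinuousOn (fun t => Γ' t x y) (Icc 0 1)) (hb'c : ∀ a, ContinuousOn (fun t => b' t a) (Icc 0 1))
    (hαdc : ∀ a, ContinuousOn (fun t => αd t a) (Icc 0 1)) (hγdc : ∀ a, ContinuousOn (fun t => γd t a) (Icc 0 1))
    (hX : ∀ t ∈ Icc (0 : ℝ) 1, X t = Γ' t + Γ t * diagonal (b' t) * Γ t + diagonal (αd t) * Γ t + Γ t * diagonal (γd t))
    (hΓm : ∀ t ∈ Icc (0 : ℝ) 1, ∀ x y, ‖Γ t x y‖ ≤ m) (x y : S × F) :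
    ‖Γ 1 x y - Γ 0 x y‖ ≤ (∫ t in (0 : ℝ)..1, ‖X t x y‖) + m ^ 2 * (∫ t in (0 : ℝ)..1, ∑ c, ‖b' t c‖) +
      m * ∫ t in (0 : ℝ)..1, (‖αd t x‖ + ‖γd t y‖) := by
  have hsub : uIcc (0 : ℝ) 1 ⊆ Icc (0 : ℝ) 1 := by rw [Set.uIcc_of_le zero_le_one]
  have hΓc : ∀ x y, ContinuousOn (fun t => Γ t x y) (Icc 0 1) := fun x y t ht => (hΓ t ht x y).continuousAt.continuousWithinAt
  -- the three non-source terms, entrywise, and their continuity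
  obtain ⟨G, hG_def⟩ : ∃ G : ℝ → ℂ, G = fun t => (Γ t * diagonal (b' t) * Γ t) x y + (diagonal (αd t) * Γ t) x y + (Γ t * diagonal (γd t)) x y :=
    ⟨_, rfl⟩
  have hGd : ContinuousOn G (Icc 0 1) := by
    have h : ∀ t, G t = (∑ a, Γ t x a * b' t a * Γ t a y) + αd t x * Γ t x y + Γ t x y * γd t y := fun t => by
      simp only [hG_def, klli_mul_diag_mul_apply, Matrix.diagonal_mul, Matrix.mul_diagonal]
    rw [show G = fun t => (∑ a, Γ t x a * b' t a * Γ t a y) + αd t x * Γ t x y + Γ t x y * γd t y from funext h]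
    exact ((continuousOn_finsetSum _ fun a _ => ((hΓc x a).mul (hb'c a)).mul (hΓc a y)).add ((hαdc x).mul (hΓc x y))).add
      ((hΓc x y).mul (hγdc y))
  have hXG : ∀ t ∈ Icc (0 : ℝ) 1, X t x y = Γ' t x y + G t := fun t ht => by
    have hXt := congrArg (fun Mx : Matrix (S × F) (S × F) ℂ => Mx x y) (hX t ht)
    simp only [Matrix.add_apply] at hXt
    rw [hXt, hG_def]; ring
  have hXc : ContinuousOn (fun t => X t x y) (Icc 0 1) := ((hΓ'c x y).add hGd).congr hXG
  have hBc : ContinuousOn (fun t => ∑ c, ‖b' t c‖) (Icc 0 1) := continuousOn_finsetSum _ fun c _ => (hb'c c).norm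
  have hLc : ContinuousOn (fun t => ‖αd t x‖ + ‖γd t y‖) (Icc 0 1) := ((hαdc x).norm).add ((hγdc y).norm)
  have hXint : IntervalIntegrable (fun t => X t x y) MeasureTheory.volume 0 1 := (hXc.mono hsub).intervalIntegrable
  have hBint : IntervalIntegrable (fun t => ∑ c, ‖b' t c‖) MeasureTheory.volume 0 1 := (hBc.mono hsub).intervalIntegrable
  have hLint : IntervalIntegrable (fun t => ‖αd t x‖ + ‖γd t y‖) MeasureTheory.volume 0 1 := (hLc.mono hsub).intervalIntegrable
  -- FTC
  have hFTC : (∫ t in (0 : ℝ)..1, Γ' t x y) = Γ 1 x y - Γ 0 x y :=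
    intervalIntegral.integral_eq_sub_of_hasDerivAt (fun t ht => hΓ t (hsub ht) x y) ((hΓ'c x y).mono hsub).intervalIntegrable
  have hid : Γ 1 x y - Γ 0 x y = ∫ t in (0 : ℝ)..1, (X t x y - G t) := by
    rw [← hFTC]
    refine intervalIntegral.integral_congr fun t ht => ?_
    show Γ' t x y = X t x y - G t
    rw [hXG t (hsub ht)]; ring
  rw [hid]
  have hg : IntervalIntegrable (fun t => ‖X t x y‖ + m ^ 2 * ∑ c, ‖b' t c‖ + m * (‖αd t x‖ + ‖γd t y‖)) MeasureTheory.volume 0 1 :=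
    (hXint.norm.add (hBint.const_mul _)).add (hLint.const_mul _)
  refine (intervalIntegral.norm_integral_le_of_norm_le zero_le_one ?_ hg).trans (le_of_eq ?_)
  · refine Filter.Eventually.of_forall fun t ht => ?_
    have ht' : t ∈ Icc (0 : ℝ) 1 := ⟨ht.1.le, ht.2⟩
    have hG1 : ‖(Γ t * diagonal (b' t) * Γ t) x y‖ ≤ m ^ 2 * ∑ c, ‖b' t c‖ := by
      refine (klell_norm_mul_diag_mul_apply_le (Γ t) (Γ t) (b' t) x y).trans ?_
      rw [mul_sum]
      exact sum_le_sum fun c _ => by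
        calc ‖Γ t x c‖ * ‖b' t c‖ * ‖Γ t c y‖ ≤ m * ‖b' t c‖ * m :=
              mul_le_mul (mul_le_mul_of_nonneg_right (hΓm t ht' x c) (norm_nonneg _)) (hΓm t ht' c y) (norm_nonneg _)
                (mul_nonneg hm (norm_nonneg _))
          _ = m ^ 2 * ‖b' t c‖ := by ring
    have hG2 : ‖(diagonal (αd t) * Γ t) x y‖ ≤ m * ‖αd t x‖ := by
      rw [Matrix.diagonal_mul, norm_mul, mul_comm]
      exact mul_le_mul_of_nonneg_right (hΓm t ht' x y) (norm_nonneg _)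
    have hG3 : ‖(Γ t * diagonal (γd t)) x y‖ ≤ m * ‖γd t y‖ := by
      rw [Matrix.mul_diagonal, norm_mul]
      exact mul_le_mul_of_nonneg_right (hΓm t ht' x y) (norm_nonneg _)
    have hGn : ‖G t‖ ≤ m ^ 2 * ∑ c, ‖b' t c‖ + m * (‖αd t x‖ + ‖γd t y‖) := by
      rw [hG_def]
      refine (norm_add_le _ _).trans ?_
      have := norm_add_le ((Γ t * diagonal (b' t) * Γ t) x y) ((diagonal (αd t) * Γ t) x y)
      nlinarith [hG1, hG2, hG3, this]
    calc ‖X t x y - G t‖ ≤ ‖X t x y‖ + ‖G t‖ := norm_sub_le _ _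
      _ ≤ ‖X t x y‖ + m ^ 2 * ∑ c, ‖b' t c‖ + m * (‖αd t x‖ + ‖γd t y‖) := by linarith
  · rw [intervalIntegral.integral_add (hXint.norm.add (hBint.const_mul _)) (hLint.const_mul _),
      intervalIntegral.integral_add hXint.norm (hBint.const_mul _), intervalIntegral.integral_const_mul, intervalIntegral.integral_const_mul]

end Generic

end Summit.HubbardSuperconductivity.HubbardSuperconductivity.Theorems.KLRegimeSplit

end
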